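import Literature.AnabelianGeometry.EtaleTheta.Discharge.Sec3Prop34CnstOfRlfRFinite
import HarnessLib

/-!
# [EtTh] Prop 3.4 (ii) / Def 3.6 (i), `Λ = ℝ`: the effective locus of `B₀^ℝ = ℝ·Φ₀^birat` is constant when every
# element of `Φ₀(Y)^pf` has FINITE prime support and the primes are `ℚ`-primes (infinitely many primes allowed)

Proof-only companion (theorems only) in the series `Discharge/Sec3*.lean`, cell abc-iut, sub-DAG
`plan/L2/SUBDAG-EtTh-Thm37.md`, row «EtTh:Thm3.7(iii)/L10-R» — GAP-LEDGER G-w5d130-1, the case left open by its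
D-row 06:16:56Z («objects `Y` with infinitely many primes»).  S. Mochizuki, *The étale theta function …*, Publ. RIMS
**45** (2009) [EtTh], §3, Prop. 3.4 (ii) p.74, Def. 3.6 (i) p.76, Thm. 3.7 (iii) p.79 (PDF)
[cite: MochizukiEtTh2009, Prop 3.4 (ii) p.74]; S. Mochizuki, *The geometry of Frobenioids I* [FrdI], Def. 2.4 (i) p.47
(`Supp(a) ⊆ Prime(M)` for `a ∈ M^rlf_factor`) [cite: MochizukiFrdI2008, Def. 2.4(i) p.47].

abc-iut-w5-d130's `RealifiedDivisorMonoids.Prop34Cnst.eff_of_finite_ratPrimes` (`Sec3Prop34CnstOfRlfRFinite.lean`)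
derives the `Λ = ℝ` effective-locus clause `hE` of `Prop34Cnst (ofRlfR dm hpf) cnst` from the `B₀`-level Prop. 3.4 (ii)
when `Φ₀(Y)` has FINITELY MANY primes, all `ℚ`-primes.  THIS FILE removes the finiteness of `Prime(Φ₀(Y))`: it
suffices that every element `a ∈ Φ₀(Y)^pf` has finite SUPPORT `Supp(a)` (the primes at which the factorization
homomorphism `M^pf → ∏_𝔮 M^rlf_𝔮` of [FrdI] Def. 2.4 (i)(c) is non-zero) — `eff_of_finSupp_ratPrimes`; the finitely
many `g_k ∈ B₀(Y)` presenting an element of `ℝ·Φ₀^birat(Y)` then involve only the finitely many primes of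
`S := ⋃_k Supp(div₀ g_k)`, off `S` every prime coordinate of every `ι(div₀ g_k)` vanishes
(`PrimeCoord.coord_toRealification_eq_one_of_not_mem_supp`), so the rational-polyhedral-cone argument runs over the
finite index type `S` and the effectivity of the rational solutions is automatic off `S`.  Corollaries:
`ofRlfR_of_finSupp_ratPrimes` (all four clauses of `Prop34Cnst (ofRlfR dm hpf) cnst`),
`TemperedFrobenioid.thm37_iii_withCnst_ofRlfR_finSupp` (Thm. 3.7 (iii) at the constructed `Λ = ℝ` data); the
finitely-many-primes case is the instance `hfs := fun _ => Set.toFinite _` (its statement is w5-d130's, not restated).  The hypothesis is sharp: without finite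
support the clause fails over `∏_{ℚ_{≥0}} ℚ_{≥0}` (all primes `ℚ`-primes; companion
`Sec3Prop34CnstOfRlfRSupportNegative.lean`).  It covers every divisor monoid of DIRECT-SUM type (finitely supported
divisors on infinitely many primes); it does not cover `Ÿ`-type objects whose log-meromorphic functions have
infinitely supported divisors (e.g. `div(U) = Σ_j j·C_j`), where `hE` needs the genuine structure of `B₀(Y)`.
HONEST FRAMING: refereed pre-IUT material; no statement of print is strengthened; nothing here bears on [IUTchIII]
Cor. 3.12.  Proof of the main theorem adapted line by line from abc-iut-w5-d130's `eff_of_finite_ratPrimes`.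
-/

noncomputable section

namespace Literature.AnabelianGeometry.EtaleTheta

open CategoryTheory Opposite Literature.AlgebraicGeometry.Frobenioids NNReal

universe u₀ v₀ u₁ v₁ u v w

/-! ### Prime coordinates vanish off the support -/

namespace PrimeCoord

/-- **Off `Supp(a)` the prime coordinate of `a ∈ M^pf ⊆ M^rlf` is trivial**: the `𝔮`-component of the factorization
homomorphism is `0` there by definition of `Supp` ([FrdI] Def. 2.4 (i)(d)). [cite: MochizukiFrdI2008, Def. 2.4(i) p.47] -/
theorem coord_toRealification_eq_one_of_not_mem_supp {M : Type w} [CommMonoid M] (h : IsPerfFactorial M)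
    (𝔮 : Primes (Perfection M)) (f : RlfAt M 𝔮 ≃* Multiplicative ℝ≥0) (a : Perfection M)
    (ha : 𝔮 ∉ Literature.AlgebraicGeometry.Frobenioids.supp (factorMap M a)) :
    coord h 𝔮 f (h.toRealification a) = 1 := by
  have h1 : factorMap M a 𝔮 = 1 := by
    by_contra hne
    exact ha hne
  rw [coord_apply]
  change f (factorMap M a 𝔮) = 1
  rw [h1, map_one]

end PrimeCoord

/-! ### Two arithmetic helpers (as in `Sec3Prop34CnstOfRlfRFinite.lean`, private there) -/

/-- `z • x = x^z` for the `ℝ`-action of a realification datum and `z ∈ ℤ`. [cite: MochizukiFrdI2008, Def. 2.4(i) p.48] -/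
private theorem rsmul_intCast' {D : Type u} [Category.{v} D] {Φ : Dᵒᵖ ⥤ CommMonCat.{w}} (R : RealificationData Φ)
    (X : D) (z : ℤ) (x : Algebra.GrothendieckGroup (R.rlf.obj (op X))) : R.rsmul X (z : ℝ) x = x ^ z := by
  cases z with
  | ofNat n => rw [Int.ofNat_eq_natCast, Int.cast_natCast, R.rsmul_natCast, zpow_natCast]
  | negSucc n => rw [Int.cast_negSucc, RealificationDataLemmas.rsmul_neg', R.rsmul_natCast, zpow_negSucc]

/-- Clearing denominators: finitely many rationals are `z_k / N` with one `N ≥ 1`. [folklore] -/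
private theorem exists_int_eq_nat_mul' {n : ℕ} (q : Fin n → ℚ) :
    ∃ N : ℕ, 0 < N ∧ ∃ z : Fin n → ℤ, ∀ k, (z k : ℚ) = (N : ℚ) * q k := by
  classical
  refine ⟨∏ k, (q k).den, Finset.prod_pos fun k _ => (q k).den_pos,
    fun k => (∏ j ∈ Finset.univ.erase k, ((q j).den : ℤ)) * (q k).num, fun k => ?_⟩
  rw [← Finset.prod_erase_mul _ _ (Finset.mem_univ k)]
  push_cast
  rw [mul_assoc, Rat.den_mul_eq_num]

/-- A fraction presentation in `Φ₀(Y)^gp`. [folklore] -/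
private theorem exists_eq_of_div_of' {N : Type w} [CommMonoid N] (ξ : Algebra.GrothendieckGroup N) :
    ∃ a b : N, ξ = Algebra.GrothendieckGroup.of a / Algebra.GrothendieckGroup.of b := by
  obtain ⟨⟨a, b⟩, hx⟩ := (Localization.monoidOf (⊤ : Submonoid N)).surj ξ
  exact ⟨a, b, eq_div_iff_mul_eq'.mpr hx⟩

namespace RealifiedDivisorMonoids.Prop34Cnst

variable {D₀ : Type u} [Category.{v} D₀] {dm : DivisorMonoids.{u, v, w} D₀}
  {hpf : ∀ Y : D₀ᵒᵖ, IsPerfFactorial (dm.Φ₀.obj Y)} {V : FrdIMonoidStub.{w}} {V₀ : FrdICatStub.{u, v, w} D₀}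
  {Dcnst : Type u₁} [Category.{v₁} Dcnst] {cnst : D₀ ⥤ Dcnst}

/-- **The `Λ = ℝ` effective-locus clause for `Φ₀(Y)` whose elements have finite prime support, all primes
`ℚ`-primes** (infinitely many primes allowed): an element `b` of `ℝ·Φ₀^birat(Y)` whose image in `(Φ₀^rlf)^gp(Y)` is the
class of an element of `Φ₀(Y)^rlf` lies in `ℝ·Φ₀^cnst(Y)` — from Prop. 3.4 (ii) at the `B₀`-level ("a function with
effective divisor is constant") by the rational-polyhedral-cone argument run over the finite set of primes
`⋃_k Supp(div₀ g_k)`. [cite: MochizukiEtTh2009, Prop 3.4 (ii) p.74] -/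
theorem eff_of_finSupp_ratPrimes (h34 : dm.Prop34 V V₀) (Y : D₀)
    (hfs : ∀ a : Perfection (dm.Φ₀.obj (op Y)),
      (Literature.AlgebraicGeometry.Frobenioids.supp (factorMap (dm.Φ₀.obj (op Y)) a)).Finite)
    (hQ : ∀ 𝔮 : Primes (Perfection (dm.Φ₀.obj (op Y))), IsQMonoprime (PfAt (dm.Φ₀.obj (op Y)) 𝔮))
    (b : Algebra.GrothendieckGroup ((realData dm hpf).rlf.obj (op Y))) (x : (hpf (op Y)).Rlf)
    (hb : b ∈ ((realData dm hpf).realSpan dm.biratGp).carrier Y) (hbx : b = Algebra.GrothendieckGroup.of x) :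
    b ∈ ((realData dm hpf).realSpan dm.cnstGp).carrier Y := by
  classical
  -- S0: coordinates `f 𝔮` of the completions `M^rlf_𝔮` (all `ℚ`-primes) and their rationality constants on `M^pf`
  have hf : ∀ 𝔮 : Primes (Perfection (dm.Φ₀.obj (op Y))),
      Nonempty (RlfAt (dm.Φ₀.obj (op Y)) 𝔮 ≃* Multiplicative ℝ≥0) :=
    fun 𝔮 => RealificationCoord.nonempty_coord (IsMonoprime.ofQ (hQ 𝔮))
  let f : ∀ 𝔮, RlfAt (dm.Φ₀.obj (op Y)) 𝔮 ≃* Multiplicative ℝ≥0 := fun 𝔮 => (hf 𝔮).some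
  have hc : ∀ 𝔮, ∃ c : ℝ≥0, c ≠ 0 ∧ ∀ a, ∃ q : ℚ≥0,
      Multiplicative.toAdd (PrimeCoord.coord (hpf (op Y)) 𝔮 (f 𝔮) ((hpf (op Y)).toRealification a)) = c * (q : ℝ≥0) :=
    fun 𝔮 => PrimeCoord.exists_nnrat_coord_toRealification 𝔮 (hQ 𝔮) (f 𝔮)
  choose cst hcst0 hcq using hc
  choose qa hqa using hcq
  -- off the support the rational coordinate `qa 𝔮 a` vanishes
  have hqa0 : ∀ (𝔮) (a : Perfection (dm.Φ₀.obj (op Y))),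
      𝔮 ∉ Literature.AlgebraicGeometry.Frobenioids.supp (factorMap (dm.Φ₀.obj (op Y)) a) → (qa 𝔮 a : ℚ) = 0 := by
    intro 𝔮 a ha
    have h0 := hqa 𝔮 a
    rw [PrimeCoord.coord_toRealification_eq_one_of_not_mem_supp (hpf (op Y)) 𝔮 (f 𝔮) a ha, toAdd_one] at h0
    have h0' : (qa 𝔮 a : ℝ≥0) = 0 := by
      rcases mul_eq_zero.mp h0.symm with h1 | h1
      · exact absurd h1 (hcst0 𝔮)
      · exact h1
    exact_mod_cast h0'
  -- S1: `b = ∏_k r_k • ι(div₀ g_k)` with `g_k ∈ B₀(Y)`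
  obtain ⟨n, r, cvec, hcvec, rfl⟩ :=
    RealificationDataLemmas.exists_prod_rsmul_of_mem_realSpan (realData dm hpf) dm.biratGp Y hb
  have hg' : ∀ k, ∃ g : dm.B₀.obj (op Y), dm.div₀ (op Y) g = cvec k :=
    fun k => exists_div₀_eq_of_mem_biratGp Y (hcvec k)
  choose g hg using hg'
  simp only [← hg] at hbx ⊢
  -- S2: `div₀ g_k = [m_k]/[m'_k]`; the rational coordinates `A 𝔮 k`
  have hmm : ∀ k, ∃ m m' : dm.Φ₀.obj (op Y),
      dm.div₀ (op Y) (g k) = Algebra.GrothendieckGroup.of m / Algebra.GrothendieckGroup.of m' :=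
    fun k => exists_eq_of_div_of' _
  choose m m' hm using hmm
  let A : Primes (Perfection (dm.Φ₀.obj (op Y))) → Fin n → ℚ := fun 𝔮 k =>
    (qa 𝔮 (Perfection.of _ (m k)) : ℚ) - qa 𝔮 (Perfection.of _ (m' k))
  -- the finite set of primes involved
  set S : Set (Primes (Perfection (dm.Φ₀.obj (op Y)))) := ⋃ k : Fin n,
    (Literature.AlgebraicGeometry.Frobenioids.supp (factorMap (dm.Φ₀.obj (op Y)) (Perfection.of _ (m k))) ∪
      Literature.AlgebraicGeometry.Frobenioids.supp (factorMap (dm.Φ₀.obj (op Y)) (Perfection.of _ (m' k))))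
    with hSdef
  have hSfin : S.Finite := Set.finite_iUnion fun k => (hfs _).union (hfs _)
  haveI : Finite S := hSfin.to_subtype
  have hA0 : ∀ 𝔮, 𝔮 ∉ S → ∀ k, A 𝔮 k = 0 := by
    intro 𝔮 h𝔮 k
    have hk : 𝔮 ∉ Literature.AlgebraicGeometry.Frobenioids.supp (factorMap (dm.Φ₀.obj (op Y)) (Perfection.of _ (m k))) ∧
        𝔮 ∉ Literature.AlgebraicGeometry.Frobenioids.supp (factorMap (dm.Φ₀.obj (op Y)) (Perfection.of _ (m' k))) := by
      constructor <;> intro h' <;> exact h𝔮 (Set.mem_iUnion.mpr ⟨k, by simp [h']⟩)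
    simp only [A, hqa0 𝔮 _ hk.1, hqa0 𝔮 _ hk.2, sub_zero]
  -- the same elements read in `(M^rlf)^gp` for `M := Φ₀(Y)` (the home of the prime coordinates)
  set ιg : Algebra.GrothendieckGroup (dm.Φ₀.obj (op Y)) →* Algebra.GrothendieckGroup (hpf (op Y)).Rlf :=
    MonGp.map ((hpf (op Y)).toRealification.comp (Perfection.of _)) with hιg
  have hP : ∀ v : Fin n → ℝ, (∏ k, (realData dm hpf).rsmul Y (v k) ((realData dm hpf).toRlfGp Y (dm.div₀ (op Y) (g k)))) =
      ∏ k, IsPerfFactorial.Rlf.realSMul (hpf (op Y)) (v k) (ιg (dm.div₀ (op Y) (g k))) := fun v => rfl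
  -- coordinates: `coordGp 𝔮 (∏_k v_k • ι(div₀ g_k)) = cst 𝔮 · Σ_k A 𝔮 k · v k`
  have hco : ∀ (𝔮) (mm : dm.Φ₀.obj (op Y)), Multiplicative.toAdd (PrimeCoord.coordGp (hpf (op Y)) 𝔮 (f 𝔮)
      (ιg (Algebra.GrothendieckGroup.of mm))) = (cst 𝔮 : ℝ) * ((qa 𝔮 (Perfection.of _ mm) : ℚ≥0) : ℝ) := by
    intro 𝔮 mm
    rw [hιg, MonGp.map_of, PrimeCoord.toAdd_coordGp_of, MonoidHom.comp_apply, hqa, NNReal.coe_mul]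
    rfl
  have hL : ∀ (𝔮) (v : Fin n → ℝ), Multiplicative.toAdd (PrimeCoord.coordGp (hpf (op Y)) 𝔮 (f 𝔮)
      (∏ k, IsPerfFactorial.Rlf.realSMul (hpf (op Y)) (v k) (ιg (dm.div₀ (op Y) (g k))))) =
        (cst 𝔮 : ℝ) * ∑ k, (A 𝔮 k : ℝ) * v k := by
    intro 𝔮 v
    rw [map_prod, toAdd_prod, Finset.mul_sum]
    refine Finset.sum_congr rfl fun k _ => ?_
    rw [PrimeCoord.toAdd_coordGp_realSMul, hm k, map_div, map_div, toAdd_div, hco, hco]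
    simp only [A]
    push_cast
    ring
  -- S3: effectivity of `b` ⇒ the RATIONAL inequalities `0 ≤ Σ_k A 𝔮 k · r k`
  have hbx' : (∏ k, IsPerfFactorial.Rlf.realSMul (hpf (op Y)) (r k) (ιg (dm.div₀ (op Y) (g k)))) =
      Algebra.GrothendieckGroup.of x := (hP r).symm.trans hbx
  have hr : ∀ 𝔮, 0 ≤ ∑ k, (A 𝔮 k : ℝ) * r k := by
    intro 𝔮
    have h0 : 0 ≤ (cst 𝔮 : ℝ) * ∑ k, (A 𝔮 k : ℝ) * r k := by
      rw [← hL 𝔮 r, hbx']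
      exact PrimeCoord.coordGp_of_nonneg 𝔮 (f 𝔮) x
    exact (mul_nonneg_iff_of_pos_left (NNReal.coe_pos.mpr (pos_iff_ne_zero.mpr (hcst0 𝔮)))).mp h0
  -- S4: `r` is a real combination of RATIONAL solutions of the finitely many constraints indexed by `S`
  have hspan := Literature.Analysis.Convex.RationalCone.mem_span_ratCast_of_forall_sum_mul_nonneg
    (J := S) (fun 𝔮 k => A 𝔮.1 k) r (fun 𝔮 => hr 𝔮.1)
  -- S5: `ℝ·Φ₀^cnst` is stable under real combinations; reduce to rational solutions
  clear hb hbx hbx' hr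
  induction hspan using Submodule.span_induction with
  | zero =>
    simp only [Pi.zero_apply, RealificationData.rsmul_zero, Finset.prod_const_one]
    exact Subgroup.one_mem _
  | add v v' _ _ hv hv' =>
    simp only [Pi.add_apply, RealificationData.rsmul_add, Finset.prod_mul_distrib]
    exact Subgroup.mul_mem _ hv hv'
  | smul s v _ hv =>
    have hs : (∏ k, (realData dm hpf).rsmul Y ((s • v) k) ((realData dm hpf).toRlfGp Y (dm.div₀ (op Y) (g k)))) =
        (realData dm hpf).rsmul Y s
          (∏ k, (realData dm hpf).rsmul Y (v k) ((realData dm hpf).toRlfGp Y (dm.div₀ (op Y) (g k)))) := by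
      rw [map_prod]
      exact Finset.prod_congr rfl fun k _ => by rw [Pi.smul_apply, smul_eq_mul, RealificationData.rsmul_mul]
    rw [hs]
    exact RealificationDataLemmas.rsmul_mem_realSpan (realData dm hpf) dm.cnstGp Y s hv
  | mem v hv =>
    -- S6: a rational solution `q = z / N` gives the function `g_q := ∏ g_k^{z k}` with EFFECTIVE divisor
    obtain ⟨q, hq, rfl⟩ := hv
    -- the constraints hold at EVERY prime: off `S` they are trivial
    have hqall : ∀ 𝔮 : Primes (Perfection (dm.Φ₀.obj (op Y))), (0 : ℝ) ≤ ∑ k, (A 𝔮 k : ℝ) * (q k : ℝ) := by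
      intro 𝔮
      by_cases h𝔮 : 𝔮 ∈ S
      · exact_mod_cast hq ⟨𝔮, h𝔮⟩
      · rw [Finset.sum_eq_zero fun k _ => by rw [hA0 𝔮 h𝔮 k, Rat.cast_zero, zero_mul]]
    obtain ⟨N, hN, z, hz⟩ := exists_int_eq_nat_mul' q
    have hzq : ∀ k, (z k : ℝ) = (N : ℝ) * (q k : ℝ) := fun k => by exact_mod_cast hz k
    let uu : Fin n → (dm.B₀.obj (op Y))ˣ := fun k => (dm.isUnit_B₀ _ (g k)).unit
    let gq : dm.B₀.obj (op Y) := ((∏ k, uu k ^ z k : (dm.B₀.obj (op Y))ˣ) : dm.B₀.obj (op Y))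
    have hdiv : dm.div₀ (op Y) gq = ∏ k, dm.div₀ (op Y) (g k) ^ z k := by
      change ((dm.div₀ (op Y)).comp (Units.coeHom _)) (∏ k, uu k ^ z k) = _
      rw [map_prod]
      exact Finset.prod_congr rfl fun k _ => by rw [map_zpow]; rfl
    -- `ι(div₀ g_q) = ∏_k z_k • ι(div₀ g_k)` (in both homes)
    have hT : (realData dm hpf).toRlfGp Y (dm.div₀ (op Y) gq) =
        ∏ k, (realData dm hpf).rsmul Y ((z k : ℝ)) ((realData dm hpf).toRlfGp Y (dm.div₀ (op Y) (g k))) := by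
      rw [hdiv, map_prod]
      exact Finset.prod_congr rfl fun k _ => by rw [map_zpow, rsmul_intCast']
    have hT' : ιg (dm.div₀ (op Y) gq) =
        ∏ k, IsPerfFactorial.Rlf.realSMul (hpf (op Y)) (z k : ℝ) (ιg (dm.div₀ (op Y) (g k))) :=
      hT.trans (hP fun k => (z k : ℝ))
    -- its coordinates are `cst 𝔮 · N · Σ_k A 𝔮 k q k ≥ 0`, so it is effective in `Φ₀^rlf`, hence in `Φ₀`
    have hpos : ∀ 𝔮, 0 ≤ Multiplicative.toAdd (PrimeCoord.coordGp (hpf (op Y)) 𝔮 (f 𝔮) (ιg (dm.div₀ (op Y) gq))) := by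
      intro 𝔮
      have hq' : (0 : ℝ) ≤ ∑ k, (A 𝔮 k : ℝ) * (q k : ℝ) := hqall 𝔮
      have hsum : ∑ k, (A 𝔮 k : ℝ) * (z k : ℝ) = (N : ℝ) * ∑ k, (A 𝔮 k : ℝ) * (q k : ℝ) := by
        rw [Finset.mul_sum]
        exact Finset.sum_congr rfl fun k _ => by rw [hzq]; ring
      rw [hT', hL, hsum]
      exact mul_nonneg (NNReal.coe_nonneg _) (mul_nonneg (Nat.cast_nonneg _) hq')
    obtain ⟨y, hy⟩ := PrimeCoord.exists_eq_of_of_coordGp_nonneg f (ιg (dm.div₀ (op Y) gq)) hpos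
    obtain ⟨x₀, hx₀, -⟩ := RlfEffective.exists_eq_of (hpf (op Y)) (dm.div₀ (op Y) gq) y (by rw [← hy, hιg]; rfl)
    -- hence `g_q ∈ F₀(Y)` (Prop 3.4 (ii)) and `div₀ g_q ∈ Φ₀^cnst`
    have hcn : dm.div₀ (op Y) gq ∈ dm.cnstGp.carrier Y :=
      dm.mem_cnstGp_of_mem_cnst Y ⟨gq, h34.mem_F₀_of_div₀_mem (op Y) gq x₀ hx₀, rfl⟩
    -- and `∏_k q_k • ι(div₀ g_k) = (1/N) • ι(div₀ g_q) ∈ ℝ·Φ₀^cnst`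
    have hLq : (∏ k, (realData dm hpf).rsmul Y ((q k : ℚ) : ℝ)
        ((realData dm hpf).toRlfGp Y (dm.div₀ (op Y) (g k)))) =
          (realData dm hpf).rsmul Y ((N : ℝ)⁻¹) ((realData dm hpf).toRlfGp Y (dm.div₀ (op Y) gq)) := by
      rw [hT, map_prod]
      refine Finset.prod_congr rfl fun k _ => ?_
      rw [← RealificationData.rsmul_mul, hzq, ← mul_assoc, inv_mul_cancel₀ (Nat.cast_ne_zero.mpr hN.ne'), one_mul]
    rw [hLq]
    exact Subgroup.subset_closure ⟨(N : ℝ)⁻¹, dm.div₀ (op Y) gq, hcn, rfl⟩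

/-- **`Prop34Cnst (ofRlfR dm hpf) cnst` — all four clauses — from the `B₀`-level Prop. 3.4 (ii) and its naturality
clauses, when every element of every `Φ₀(Y)^pf` has finite prime support and all primes are `ℚ`-primes** (infinitely
many primes allowed). [cite: MochizukiEtTh2009, Prop 3.4 (ii) p.74] -/
theorem ofRlfR_of_finSupp_ratPrimes (h34 : dm.Prop34 V V₀) (h₀ : dm.Prop34Cnst₀ cnst)
    (hfs : ∀ (Y : D₀) (a : Perfection (dm.Φ₀.obj (op Y))),
      (Literature.AlgebraicGeometry.Frobenioids.supp (factorMap (dm.Φ₀.obj (op Y)) a)).Finite)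
    (hQ : ∀ (Y : D₀) (𝔮 : Primes (Perfection (dm.Φ₀.obj (op Y)))), IsQMonoprime (PfAt (dm.Φ₀.obj (op Y)) 𝔮)) :
    (ofRlfR dm hpf).Prop34Cnst cnst :=
  ofRlfR_of_eff h₀ fun Y b x hb hbx => eff_of_finSupp_ratPrimes h34 Y (hfs Y) (hQ Y) b x hb hbx

end RealifiedDivisorMonoids.Prop34Cnst

/-! ### Theorem 3.7 (iii) over the constructed `Λ = ℝ` data, finite supports, `ℚ`-primes -/

namespace TemperedFrobenioid

variable {D₀ : Type u} [Category.{v} D₀] {dm : DivisorMonoids.{u, v, w} D₀}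
  {hpf : ∀ Y : D₀ᵒᵖ, IsPerfFactorial (dm.Φ₀.obj Y)} {V : FrdIMonoidStub.{w}} {V₀ : FrdICatStub.{u, v, w} D₀}
  {D : Type u₀} [Category.{v₀} D] {VD : FrdICatStub.{u₀, v₀, w} D}
  (C₀ : TemperedFrobenioid (RealifiedDivisorMonoids.ofRlfR dm hpf) D VD)
  {Dcnst : Type u₁} [Category.{v₁} Dcnst] {cnst : D₀ ⥤ Dcnst}

/-- **Theorem 3.7 (iii) for a tempered Frobenioid of monoid type `ℝ` over the CONSTRUCTED data `ofRlfR dm hpf`**, at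
the instantiated facade, modulo ONLY the `B₀`-level statements `dm.Prop34` and `dm.Prop34Cnst₀ cnst`, when every
element of every `Φ₀(Y)^pf` has finite prime support and all primes are `ℚ`-primes (infinitely many primes allowed).
[cite: MochizukiEtTh2009, Thm 3.7 (iii) p.79] -/
theorem thm37_iii_withCnst_ofRlfR_finSupp (F : FrobenioidFacade.{u₀, v₀, w} D) (h34 : dm.Prop34 V V₀)
    (h₀ : dm.Prop34Cnst₀ cnst)
    (hfs : ∀ (Y : D₀) (a : Perfection (dm.Φ₀.obj (op Y))),
      (Literature.AlgebraicGeometry.Frobenioids.supp (factorMap (dm.Φ₀.obj (op Y)) a)).Finite)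
    (hQ : ∀ (Y : D₀) (𝔮 : Primes (Perfection (dm.Φ₀.obj (op Y)))), IsQMonoprime (PfAt (dm.Φ₀.obj (op Y)) 𝔮)) :
    C₀.Thm37_iii (F.withCnst (C₀.base ⋙ cnst)) :=
  C₀.thm37_iii_withCnst F (RealifiedDivisorMonoids.Prop34Cnst.ofRlfR_of_finSupp_ratPrimes h34 h₀ hfs hQ)

end TemperedFrobenioid

end Literature.AnabelianGeometry.EtaleTheta

end
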